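import Summits.AtomisticToContinuum.Crystallization.Theorems.FrustratedLawDichotomyStrainedPatchHomPruned

/-!
# The RADIAL-SPREAD prune and an exact isometry supplier for the fit prune
# (27623 strained-patch piece, `(H) HomFloor` certificate interface; decomp-a2c, prover hand 2, generation 20; sequel to `…HomPruned`)

Two further DEF-FREE pieces of certificate interface:

* §1 ★ **(P2′) RADIAL SPREAD** (`not_goodAtScale_centre_of_radialSpread`): if `w₀` is a shortest nonzero displacement (against all of `T ∖ 0` of norm
  `≤ D`) and some displacement `w ∈ T` has `(1 + η)·‖w₀‖ < ‖w‖ < 13/10·‖w₀‖`, then the centre is NOT `η`-good at any scale `≤ D`: a two-shell fit pins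
  its scale to `‖w₀‖`, must enlist `w` (clean gap), and then bounds `‖w‖ ≤ (1 + η')·‖w₀‖` — the twelve-point patterns lie on the unit sphere.
  At `η = 1/8` this is a PRUNE (`BadNearCap` at the centre ⟹ inadmissible: `pruneFcc/Hcp_of_radialSpread`), complementary to the intruder prune (P2)
  (it fires on radially split shells WITHOUT a thirteenth vector, e.g. along Bain/uniaxial paths); at `η = 1/20` it is the typed form of the
  «radial spread `r₁₂/r₁ ≥ 1.0502` ⟹ not tight» reading of the measured family A (GATE-g43), i.e. a NON-tightness certificate for witnesses.
* §2 ★ **EXACT ISOMETRIES FROM ORTHONORMAL COLUMNS** (critic row 768 (n1)): `exists_linearIsometry_of_orthonormal` — three orthonormal vectors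
  `c₀ c₁ c₂` (rational entries, orthonormality = nine rational identities via `orthonormal_iff_ite`) give a linear isometry `A` with
  `A v = Σ vᵢ • cᵢ`, so the fit prune's `A u` is computed exactly per leaf.

0 sorry; no definitions; axioms ⊆ {propext, Classical.choice, Quot.sound}.  `--supports stmt-AtomisticToContinuum-27623`.
-/

noncomputable section

namespace Summit.AtomisticToContinuum.Crystallization.Theorems.FrustratedLawDichotomyStrainedPatchHomPrunesSpread

open scoped BigOperators Classical
open Literature.Geometry.DiscreteGeometry
  (fccKissingPattern hcpKissingPattern norm_eq_one_of_mem_fccKissingPattern norm_eq_one_of_mem_hcpKissingPattern)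
open Summit.AtomisticToContinuum.Crystallization.Theorems.ChargedEnergyGapNegative (E3)
open Summit.AtomisticToContinuum.Crystallization.Theorems.FrustratedLawDichotomyRangeCut (Sep)
open Summit.AtomisticToContinuum.Crystallization.Theorems.FrustratedLawDichotomyMotifLemmas (GoodAtScale)
open Summit.AtomisticToContinuum.Crystallization.Theorems.FrustratedLawDichotomyAveragingCut (ball self_mem_ball)
open Summit.AtomisticToContinuum.Crystallization.Theorems.FrustratedLawDichotomyAveragingRuleTightFree (TightNearCap BadNearCap)
open Summit.AtomisticToContinuum.Crystallization.Theorems.FrustratedLawDichotomyExemptAbsorption (ExemptNear)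
open Summit.AtomisticToContinuum.Crystallization.Theorems.FrustratedLawDichotomyStrainedPatchHomSplit
open Summit.AtomisticToContinuum.Crystallization.Theorems.FrustratedLawDichotomyStrainedPatchHomPrunes
open Summit.AtomisticToContinuum.Crystallization.Theorems.FrustratedLawDichotomyStrainedPatchHomPrunesFit
open Literature.Barriers.AtomisticToContinuum.FlatleyTheil2015 (fccVec)

/-! ## §1. (P2′) The radial-spread obstruction to a two-shell fit -/

/-- ★ **(P2′) RADIAL SPREAD ⟹ the centre is not `η`-good at scale `≤ D`.**  Data: a shortest nonzero displacement `w₀` (against `T ∖ 0` up to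
norm `D`) and a displacement `w ∈ T` in the radial gap `(1 + η)·‖w₀‖ < ‖w‖ < 13/10·‖w₀‖`; both within `15/2`. [folklore] -/
theorem not_goodAtScale_centre_of_radialSpread {M : ℕ} {z : Fin M → E3} {c : Fin M} {T : Set E3}
    (hT : ∀ x : E3, dist x (z c) < 15 / 2 → (x ∈ Set.range z ↔ x - z c ∈ T)) {η D : ℝ} (hη0 : 0 ≤ η) (hD : D < 15 / 2)
    {w₀ w : E3} (hw₀T : w₀ ∈ T) (hw₀0 : w₀ ≠ 0) (hw₀7 : ‖w₀‖ < 15 / 2) (hmin : ∀ w' ∈ T, w' ≠ 0 → ‖w'‖ ≤ D → ‖w₀‖ ≤ ‖w'‖)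
    (hwT : w ∈ T) (hw7 : ‖w‖ < 15 / 2) (hlo : (1 + η) * ‖w₀‖ < ‖w‖) (hhi : ‖w‖ < 13 / 10 * ‖w₀‖) : ¬GoodAtScale η D z c := by
  rintro ⟨d, η', γ, A, hdD, hor⟩
  have key : ∀ {P : Finset E3} (t : ↥P → E3), (∀ u : ↥P, ‖(u : E3)‖ = 1) → 0 < d → 0 < γ → η' < η →
      (∀ u : ↥P, t u ∈ Set.range z ∧ ‖(t u - z c) - d • A (u : E3)‖ ≤ η' * d) →
      (∀ s : E3, s ∈ Set.range z → s ≠ z c → d ≤ dist s (z c)) →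
      (∃ s : E3, s ∈ Set.range z ∧ s ≠ z c ∧ dist s (z c) ≤ d) →
      (∀ s : E3, s ∈ Set.range z → s ≠ z c → dist s (z c) < 13 / 10 * d + γ → dist s (z c) ≤ 13 / 10 * d - γ ∧ s ∈ Set.range t) → False := by
    intro P t hP1 hd0 hγ0 hη hfit hlow hex hclean
    -- the scale is pinned to `‖w₀‖`
    have hd1 : d ≤ ‖w₀‖ := by
      have := hlow (z c + w₀) (mem_range_of_mem hT hw₀T hw₀7) (fun h => hw₀0 (by simpa using h))
      simpa [dist_eq_norm] using this
    have hd2 : ‖w₀‖ ≤ d := by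
      obtain ⟨s, hs, hne, hsd⟩ := hex
      have hw' : s - z c ∈ T := sub_mem_of_mem_range hT hs (by linarith)
      have hsd' : ‖s - z c‖ ≤ d := by rwa [← dist_eq_norm]
      exact (hmin _ hw' (sub_ne_zero.2 hne) (by linarith)).trans hsd'
    -- the long displacement must be one of the twelve fitted ones
    have hw0 : w ≠ 0 := by
      intro h
      rw [h, norm_zero] at hlo
      nlinarith [norm_nonneg w₀]
    have hxmem := mem_range_of_mem hT hwT hw7
    obtain ⟨-, u, hu⟩ := hclean (z c + w) hxmem (fun h => hw0 (by simpa using h)) (by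
      have : dist (z c + w) (z c) = ‖w‖ := by simp [dist_eq_norm]
      rw [this]; nlinarith)
    have hfu := (hfit u).2
    rw [hu, add_sub_cancel_left] at hfu
    -- `‖w‖ ≤ d + η' d`
    have hAu : ‖d • A (u : E3)‖ = d := by
      rw [norm_smul, LinearIsometry.norm_map, hP1 u, mul_one, Real.norm_eq_abs, abs_of_pos hd0]
    have hle : ‖w‖ ≤ d + η' * d := by
      have := norm_le_norm_add_norm_sub' w (d • A (u : E3))
      have h2 : ‖w - d • A (u : E3)‖ ≤ η' * d := hfu
      calc ‖w‖ ≤ ‖d • A (u : E3)‖ + ‖w - d • A (u : E3)‖ := norm_le_insert' _ _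
        _ ≤ d + η' * d := by rw [hAu]; linarith
    have hdd : d = ‖w₀‖ := le_antisymm hd1 hd2
    rw [hdd] at hle
    nlinarith [norm_nonneg w₀]
  rcases hor with ⟨t, hd0, hγ0, hη, hfit, hlow, hex, hclean⟩ | ⟨t, hd0, hγ0, hη, hfit, hlow, hex, hclean⟩
  · exact key t (fun u => norm_eq_one_of_mem_fccKissingPattern u.2) hd0 hγ0 hη hfit hlow hex hclean
  · exact key t (fun u => norm_eq_one_of_mem_hcpKissingPattern u.2) hd0 hγ0 hη hfit hlow hex hclean

/-- ★★ **(P2′) PRUNE, fcc**: a radial spread beyond `1/8` in `G·L_fcc` (`(1 + 1/8)‖w₀‖ < ‖w‖ < 13/10·‖w₀‖`, `w₀` shortest up to `3/2`) makes the centre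
`1/8`-bad ⟹ the prune disjunct of `homFloor_of_prunedBoxSums`. [folklore] -/
theorem pruneFcc_of_radialSpread {G : E3 →L[ℝ] E3} {w₀ w : E3}
    (hw₀T : w₀ ∈ {v : E3 | ∃ b : Fin 3 → ℤ, v = latPt G fccVec b}) (hw₀0 : w₀ ≠ 0) (hw₀7 : ‖w₀‖ < 15 / 2)
    (hmin : ∀ w' ∈ {v : E3 | ∃ b : Fin 3 → ℤ, v = latPt G fccVec b}, w' ≠ 0 → ‖w'‖ ≤ 3 / 2 → ‖w₀‖ ≤ ‖w'‖)
    (hwT : w ∈ {v : E3 | ∃ b : Fin 3 → ℤ, v = latPt G fccVec b}) (hw7 : ‖w‖ < 15 / 2) (hlo : (1 + 1 / 8) * ‖w₀‖ < ‖w‖)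
    (hhi : ‖w‖ < 13 / 10 * ‖w₀‖) :
    ∀ (M : ℕ) (z : Fin M → E3) (c : Fin M), Function.Injective z →
      Set.range z = {x : E3 | dist x (z c) ≤ 133 / 10 ∧ ∃ a : Fin 3 → ℤ, x = z c + latPt G fccVec a} →
      TightNearCap (9 / 5) (3 / 2) z c ∨ ExemptNear (9 / 5) ExRec z c ∨ BadNearCap (9 / 5) (3 / 2) z c :=
  fun M z c _ hrange => Or.inr (Or.inr ⟨c, self_mem_ball (by norm_num) z c,
    not_goodAtScale_centre_of_radialSpread (locHom_fcc_centre hrange) (by norm_num) (by norm_num) hw₀T hw₀0 hw₀7 hmin hwT hw7 hlo hhi⟩)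

/-- ★★ **(P2′) PRUNE, hcp** (displacement set `T_A`). [folklore] -/
theorem pruneHcp_of_radialSpread {G : E3 →L[ℝ] E3} {ξ : E3} {w₀ w : E3}
    (hw₀T : w₀ ∈ {v : E3 | ∃ b : Fin 3 → ℤ, v = latPt G hexFrame b ∨ v = latPt G hexFrame b + G (hcpShift + ξ)}) (hw₀0 : w₀ ≠ 0)
    (hw₀7 : ‖w₀‖ < 15 / 2)
    (hmin : ∀ w' ∈ {v : E3 | ∃ b : Fin 3 → ℤ, v = latPt G hexFrame b ∨ v = latPt G hexFrame b + G (hcpShift + ξ)},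
      w' ≠ 0 → ‖w'‖ ≤ 3 / 2 → ‖w₀‖ ≤ ‖w'‖)
    (hwT : w ∈ {v : E3 | ∃ b : Fin 3 → ℤ, v = latPt G hexFrame b ∨ v = latPt G hexFrame b + G (hcpShift + ξ)}) (hw7 : ‖w‖ < 15 / 2)
    (hlo : (1 + 1 / 8) * ‖w₀‖ < ‖w‖) (hhi : ‖w‖ < 13 / 10 * ‖w₀‖) :
    ∀ (M : ℕ) (z : Fin M → E3) (c : Fin M), Function.Injective z →
      Set.range z = {x : E3 | dist x (z c) ≤ 133 / 10 ∧ ∃ a : Fin 3 → ℤ,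
        x = z c + latPt G hexFrame a ∨ x = z c + latPt G hexFrame a + G (hcpShift + ξ)} →
      ¬Sep z ∨ TightNearCap (9 / 5) (3 / 2) z c ∨ ExemptNear (9 / 5) ExRec z c ∨ BadNearCap (9 / 5) (3 / 2) z c :=
  fun M z c _ hrange => Or.inr (Or.inr (Or.inr ⟨c, self_mem_ball (by norm_num) z c,
    not_goodAtScale_centre_of_radialSpread (locHom_hcp_centre hrange) (by norm_num) (by norm_num) hw₀T hw₀0 hw₀7 hmin hwT hw7 hlo hhi⟩))

/-! ## §2. Exact isometries from orthonormal columns (critic row 768 (n1)) -/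

/-- ★ **An orthonormal triple of vectors is the column set of a linear isometry**: `∃ A : E3 →ₗᵢ[ℝ] E3, A v = Σ vᵢ • cᵢ`.  With rational `cᵢ`
(orthonormality = nine rational identities, `orthonormal_iff_ite`) the fit prune's `A u` is an explicit rational vector per pattern point. [folklore] -/
theorem exists_linearIsometry_of_orthonormal {col : Fin 3 → E3} (hc : Orthonormal ℝ col) :
    ∃ A : E3 →ₗᵢ[ℝ] E3, ∀ v : E3, A v = ∑ i : Fin 3, v i • col i := by
  have hcard : Fintype.card (Fin 3) = Module.finrank ℝ E3 := by simp
  have hsp : ⊤ ≤ Submodule.span ℝ (Set.range col) := (hc.linearIndependent.span_eq_top_of_card_eq_finrank' hcard).ge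
  let b : OrthonormalBasis (Fin 3) ℝ E3 := OrthonormalBasis.mk hc hsp
  refine ⟨b.repr.symm.toLinearIsometry, fun v => ?_⟩
  have hb : ∀ i, b i = col i := fun i => by simp [b]
  rw [LinearIsometryEquiv.coe_toLinearIsometry, ← b.sum_repr_symm v]
  simp [hb]

/-- Orthonormality of a triple as nine inner-product identities (what a certificate checks, in `ℚ`). [folklore] -/
theorem orthonormal_of_inner {col : Fin 3 → E3} (h : ∀ i j : Fin 3, inner ℝ (col i) (col j) = if i = j then (1 : ℝ) else 0) :
    Orthonormal ℝ col :=
  orthonormal_iff_ite.2 h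

end Summit.AtomisticToContinuum.Crystallization.Theorems.FrustratedLawDichotomyStrainedPatchHomPrunesSpread

end
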